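import Literature.NumberTheory.DiophantineGeometry.StewartPadicOrder
import Literature.NumberTheory.DiophantineGeometry.StewartYuPadicLogFormsReduction
import Mathlib.NumberTheory.Height.NumberField
import Mathlib.NumberTheory.Chebyshev
import Mathlib.Analysis.Complex.ExponentialBounds
import Mathlib.NumberTheory.Padics.PadicVal.Basic
import Mathlib.Data.Nat.Factorization.Basic
import HarnessLib

/-!
# Stewart 2013, Lemma 8 (integer case) and Theorem 2 from Lemma 5 (Yu 2013): the inflation argument

Topic `NumberTheory/DiophantineGeometry`; namespace `Literature.NumberTheory.DiophantineGeometry.Dioph`.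
Companion ("Proofs") file of `StewartPadicOrder.lean`, whose named fact
`stewart2013_thm2` (C. L. Stewart, *On divisors of Lucas and Lehmer numbers*, Acta Math. 211
(2013) = arXiv:1008.1274, Theorem 2) was reduced there (§6 of the paper) to the integer case of
the paper's **Lemma 8** (`stewart2013_thm2_of_lemma8Int`).

Here the printed proof of Lemma 8 in the case `ℚ(α/β) = ℚ` (arXiv pp. 9–10) is formalized, its
single deep input — **Lemma 5** (arXiv p. 8), i.e. the Main Theorem of K. Yu, *p-adic logarithmic
forms and a problem of Erdős*, Acta Math. 211 (2013) 315–382 ([SY2] in the paper), as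
specialised by Stewart — appearing as the explicit hypothesis `hY` of the theorems of §E,
spelled out for `K = ℚ` (`d = 1`, `f_℘ = 1`, `℘ = p` unramified, `δ ≥ 1` replaced by `1`, heights
`h = Height.logHeight₁` on `ℚ`), and in §F supplied by the tree's named fact
`Stewart2013_lemma5_rat` (`StewartYuPadicLogForms.lean`: Lemma 5 over `ℚ` in the form the
published argument establishes), giving the PROVED implication
`Stewart2013_lemma5_rat → stewart2013_thm2` (`stewart2013_thm2_of_Stewart2013_lemma5_rat`).
No named fact and no `Prop`-valued definition is introduced here; the only definition is the
concrete family `auxFamily`. The remaining debt of `stewart2013_thm2` is thereby exactly the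
named fact `Stewart2013_lemma5_rat`, i.e. (for `n ≥ 2` logarithms) K. Yu's theorem on `p`-adic
logarithmic forms over `ℚ` (Baker's theory in the `p`-adic setting, not available in Lean).

## The printed proof and its rendering

"An unusual feature of the proof of Lemma 8 is that we artificially inflate the number of terms
which occur in the `p`-adic linear form in logarithms" (arXiv p. 4). With `k = [log p / 51.8 log log p]`
((28)) and `p₂, …, p_k` the smallest primes not dividing `pαβ`, one writes
`θ^m − 1 = (θ/p₂⋯p_k)^m p₂^m ⋯ p_k^m − 1` ((31)) and applies Lemma 5 with `n = k` logarithms,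
whose `p`-dependence `p (k/log p)^k` then produces the saving `exp(−log p / 51.9 log log p)`
((33)–(38)), using `Σ log p_j ≤ 1.001 (k−1) log k` ((34), prime number theorem) and the AM–GM
inequality ((35)).

* §A `exists_log_nth_prime_le`: (34) in the form `log p_{k+t} ≤ 1.001 log k` for `k ≥ k₁`,
  `t ≤ k`, from Chebyshev's bound `p_m ≤ 45 m log m` (re-derived inside the proof from Mathlib's
  `Chebyshev.pi_ge`, as in the tree's `Literature.NumberTheory.Sieve.nth_prime_le_mul_log`, which
  is deliberately not imported: its closure is the sieve/Tauberian development; the paper cites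
  the prime number theorem with error term — only the existence of the threshold matters). We bound each `log p_j` by `log p_{k+t}` directly, which makes (35)
  (AM–GM) unnecessary.
* §B `exists_auxPrimes`: `k − 1` primes outside a forbidden set of size `≤ t + 1` among the first
  `k + t` primes.
* §C `auxFamily` and its algebra: the product formula (31) (`prod_auxFamily_zpow`), `p`-adic units
  (`padicValRat_auxFamily`), multiplicative independence (`auxFamily_multIndep`, by comparing
  `ord_r` at a prime `r` with `ord_r a ≠ ord_r b` and then `ord_q`, `q = p_j`), heights
  (`logHeight₁_auxFamily_none_le`, (36): `h(α₁) ≤ log a + log b + Σ log p_j`), and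
  `ord_p((a/b)ⁿ − 1) = ord_p(aⁿ − bⁿ)` (`padicValRat_div_pow_sub_one`). In the integer case we
  take `θ = a/b` itself (`v = 0`, `m = n`): the `2^v`-descent (24)–(27) of the paper is only used
  for the quadratic case ((41)–(44)) and Lemma 5 is applied with `δ = 1` anyway (arXiv p. 9,
  "We now apply Lemma 5 with `δ = 1`, `d = 1`, `f_℘ = 1` and `n = k`").
* §D the real-variable estimates with explicit constants: (29) (`exp_pow_mul_le`), the chain
  (33)–(37) (`lemma5_rhs_le`: the right side of Lemma 5 is `≤ 26000 k⁵ (7e(p−1)/(p−2) · 1.001 k log k / log p)^k p log a log n`),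
  the base of the `k`-th power is `≤ e⁻¹` for `p ≥ 2090` (`base_le_exp_neg_one`; this is where
  `51.8 > 7 · 1.001 · e²` enters) and the absorption (38) (`absorb_pow_le_exp`, using
  `1/51.8 − 1/51.9 = 1/26884.2` and `(log log p)² = o(log p)`).
* §E `stewart2013_lemma8Int_of_lemma5Rat_seven_le` (Lemma 8, integer case, from the printed
  Lemma 5 over `ℚ` indexed by `Fin n` and required only for `n ≥ 7` logarithms — the proof takes
  `n = k ≥ 7`; the inflated family on `Option P` is re-indexed by `Fin k`),
  `stewart2013_lemma8Int_of_lemma5Rat` (the same from `hY` for an arbitrary finite index type, a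
  corollary) and `stewart2013_thm2_of_lemma5Rat` (Theorem 2 from `hY`, via
  `stewart2013_thm2_of_lemma8Int` of the main file). The threshold is
  `C(t) = exp(max(e^{12}, L₁, (103.6 (max(k₁, t) + 4))²))`, `L₁` from `161400 (log L)² ≤ L` —
  "effectively computable in terms of `ω(ab)`" in the paper; here merely a function of `t = ω(ab)`.
* §F `stewart2013_lemma8Int_of_Stewart2013_lemma5_rat` and
  `stewart2013_thm2_of_Stewart2013_lemma5_rat`: Lemma 8 (integer case) and **Theorem 2 from the
  named fact `Stewart2013_lemma5_rat`**. That fact is stated (since its restatement of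
  2026-08-15) in the `(3.2)–(3.3)` form `max(log B, G₁^ℚ(n))`; by
  `Stewart2013_lemma5_rat.printed_of` it yields the printed `max(log B, (n+1) · 5.4n)` for
  `n ≥ 7` (`yuG1Rat_le_printed`), which is all that §E consumes, and `δ ≥ 1`
  (`one_le_stewartDelta`, `stewartC_anti`) replaces `δ` by `1`.

## References

* [Stewart2013] C. L. Stewart, *On divisors of Lucas and Lehmer numbers*, Acta Math. 211 (2013)
  291–314 = arXiv:1008.1274 — Lemma 5 (p. 8), Lemma 8 and its proof (pp. 9–10), (28)–(38).
* [Yu2013] K. Yu, *p-adic logarithmic forms and a problem of Erdős*, Acta Math. 211 (2013)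
  315–382 — Main Theorem (the content of Lemma 5; not proved here).
-/

noncomputable section

open Height Real Finset

namespace Literature.NumberTheory.DiophantineGeometry.Dioph

/-! ### §A. Chebyshev: `p_m ≤ 45 m log m`, hence `log p_{k+t} ≤ 1.001 log k` for large `k` -/

/-- `6 + log u ≤ 0.001 u` for all large real `u` (`log u = o(u)`). [folklore] -/
theorem eventually_const_add_log_le : ∃ u₀ : ℝ, ∀ u : ℝ, u₀ ≤ u → 6 + Real.log u ≤ 0.001 * u := by
  have h := Real.isLittleO_log_id_atTop.def (show (0 : ℝ) < 0.0005 by norm_num)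
  obtain ⟨u₀, hu₀⟩ := Filter.eventually_atTop.mp h
  refine ⟨max u₀ 12000, fun u hu => ?_⟩
  have h1 := hu₀ u (le_trans (le_max_left _ _) hu)
  have hu1 : (12000 : ℝ) ≤ u := le_trans (le_max_right _ _) hu
  rw [Real.norm_eq_abs, Real.norm_eq_abs, id, abs_of_nonneg (by linarith : (0 : ℝ) ≤ u)] at h1
  have := le_abs_self (Real.log u)
  linarith

/-- **The prime-number-theorem input of [Stewart2013], (34)** in the crude form that suffices:
there is `k₁` such that for all `k ≥ k₁` and `t ≤ k`, `log p_{k+t} ≤ 1.001 · log k`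
(`p_i = Nat.nth Nat.Prime i`). From Chebyshev's `p_m ≤ 45 m log m` (`m ≥ 2`; derived inside the
proof from Mathlib's `Chebyshev.pi_ge : (n log 2 − log(n+1))/log n ≤ π(n)` exactly as in the
tree's `Literature.NumberTheory.Sieve.nth_prime_le_mul_log`, which is not imported here to keep
this file's import closure free of the sieve/Tauberian development): `p_{k+t} ≤ 180 k log k`, and
`log 180 + log log k ≤ 6 + log log k ≤ 0.001 log k` for large `k`. (The paper invokes the prime number theorem
with error term; Chebyshev's bound is enough for the existence of the threshold.)
[cite: Stewart2013, proof of Lemma 8, (34) (arXiv p. 10)] -/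
theorem exists_log_nth_prime_le :
    ∃ k₁ : ℕ, 3 ≤ k₁ ∧ ∀ k t : ℕ, k₁ ≤ k → t ≤ k →
      Real.log (Nat.nth Nat.Prime (k + t)) ≤ 1.001 * Real.log k := by
  obtain ⟨u₀, hu₀⟩ := eventually_const_add_log_le
  refine ⟨max 3 (⌈Real.exp u₀⌉₊ + 1), le_max_left _ _, fun k t hk ht => ?_⟩
  have hk3 : 3 ≤ k := le_trans (le_max_left _ _) hk
  have hk3r : (3 : ℝ) ≤ k := by exact_mod_cast hk3
  have hkexp : Real.exp u₀ ≤ k := by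
    have h1 : ⌈Real.exp u₀⌉₊ + 1 ≤ k := le_trans (le_max_right _ _) hk
    have h2 : ((⌈Real.exp u₀⌉₊ + 1 : ℕ) : ℝ) ≤ k := by exact_mod_cast h1
    push_cast at h2
    linarith [Nat.le_ceil (Real.exp u₀)]
  have hlogk : u₀ ≤ Real.log k := by
    rw [← Real.log_exp u₀]; exact Real.log_le_log (Real.exp_pos _) hkexp
  have hkey := hu₀ (Real.log k) hlogk
  -- `p_{k+t} ≤ 45 (k+t) log (k+t) ≤ 180 k log k`
  have hm : 2 ≤ k + t := by omega
  -- Chebyshev: `p_m ≤ 45 m log m` for `m ≥ 2` (as in `Literature.NumberTheory.Sieve.nth_prime_le_mul_log`)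
  have hcheb : ∀ m : ℕ, 2 ≤ m → (Nat.nth Nat.Prime m : ℝ) ≤ 45 * m * Real.log m := by
    intro m hm
    set P := Nat.nth Nat.Prime m with hPdef
    have hP : P.Prime := Nat.prime_nth_prime m
    have hmP : m + 2 ≤ P := Nat.add_two_le_nth_prime m
    have hP4 : (4 : ℝ) ≤ P := by exact_mod_cast (show 4 ≤ P by omega)
    have hm2 : (2 : ℝ) ≤ m := by exact_mod_cast hm
    have hpi : (Nat.primeCounting P : ℝ) = m + 1 := by
      have : Nat.primeCounting P = m + 1 := by
        rw [Nat.primeCounting, Nat.primeCounting', Nat.count_succ, if_pos hP,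
          ← Nat.primeCounting', hPdef, Nat.primeCounting'_nth_eq]
      exact_mod_cast this
    have hch := Chebyshev.pi_ge P
    rw [hpi] at hch
    have hlogP : Real.log 4 ≤ Real.log P := Real.log_le_log (by norm_num) hP4
    have hlog4 : (1 : ℝ) < Real.log 4 := by
      rw [show (4 : ℝ) = 2 ^ 2 by norm_num, Real.log_pow]
      have := Real.log_two_gt_d9
      push_cast
      linarith
    have hlogPpos : 0 < Real.log P := by linarith
    rw [div_le_iff₀ hlogPpos] at hch
    have hlogP1 : Real.log (P + 1) ≤ Real.log 2 + Real.log P := by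
      rw [← Real.log_mul (by norm_num) (by positivity)]
      exact Real.log_le_log (by positivity) (by linarith)
    have hlog2 : (1 / 2 : ℝ) < Real.log 2 := by have := Real.log_two_gt_d9; linarith
    have hlog2' : Real.log 2 ≤ Real.log P := Real.log_le_log (by norm_num) (by linarith)
    have h1 : (P : ℝ) ≤ 5 * m * Real.log P := by nlinarith
    have hsqrt : Real.log P ≤ 2 * Real.sqrt P := by
      have := Real.log_le_rpow_div (x := (P : ℝ)) (ε := 1 / 2) (by positivity) (by norm_num)
      rw [← Real.sqrt_eq_rpow] at this
      linarith
    have hPsq : (P : ℝ) = Real.sqrt P * Real.sqrt P := (Real.mul_self_sqrt (by positivity)).symm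
    have hsqrtle : Real.sqrt P ≤ 10 * m := by
      have hs : 0 < Real.sqrt P := Real.sqrt_pos.2 (by linarith)
      nlinarith
    have hP100 : (P : ℝ) ≤ 100 * m ^ 2 := by
      have hs : 0 ≤ Real.sqrt P := Real.sqrt_nonneg _
      nlinarith
    have hlogm : Real.log 2 ≤ Real.log m := Real.log_le_log (by norm_num) hm2
    have hlogP9 : Real.log P ≤ 9 * Real.log m := by
      have h100 : Real.log 100 ≤ 7 * Real.log 2 := by
        rw [← Real.log_rpow (by norm_num)]
        exact Real.log_le_log (by norm_num) (by norm_num)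
      calc Real.log P ≤ Real.log (100 * m ^ 2) := Real.log_le_log (by positivity) hP100
        _ = Real.log 100 + 2 * Real.log m := by
          rw [Real.log_mul (by norm_num) (by positivity), Real.log_pow]; push_cast; ring
        _ ≤ 9 * Real.log m := by linarith
    have hm0 : (0 : ℝ) ≤ m := by positivity
    calc (P : ℝ) ≤ 5 * m * Real.log P := h1
      _ ≤ 5 * m * (9 * Real.log m) := by gcongr
      _ = 45 * m * Real.log m := by ring
  have hM := hcheb (k + t) hm
  have hkt : ((k + t : ℕ) : ℝ) ≤ 2 * k := by push_cast; exact_mod_cast (by omega : k + t ≤ 2 * k)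
  have hlog2 : Real.log 2 ≤ Real.log k := Real.log_le_log (by norm_num) (by linarith)
  have hlogk1 : 1 ≤ Real.log k := by
    rw [← Real.log_exp 1]
    refine Real.log_le_log (Real.exp_pos 1) ?_
    have := Real.exp_one_lt_d9; linarith
  have hlogkt : Real.log ((k + t : ℕ) : ℝ) ≤ 2 * Real.log k := by
    calc Real.log ((k + t : ℕ) : ℝ) ≤ Real.log (2 * k) :=
          Real.log_le_log (by positivity) hkt
      _ = Real.log 2 + Real.log k := Real.log_mul (by norm_num) (by positivity)
      _ ≤ 2 * Real.log k := by linarith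
  have hM' : (Nat.nth Nat.Prime (k + t) : ℝ) ≤ 180 * k * Real.log k := by
    calc (Nat.nth Nat.Prime (k + t) : ℝ) ≤ 45 * ((k + t : ℕ) : ℝ) * Real.log ((k + t : ℕ) : ℝ) := hM
      _ ≤ 45 * (2 * k) * (2 * Real.log k) := by gcongr
      _ = 180 * k * Real.log k := by ring
  have hMpos : (0 : ℝ) < Nat.nth Nat.Prime (k + t) := by
    exact_mod_cast (Nat.prime_nth_prime (k + t)).pos
  have h180 : Real.log 180 ≤ 6 := by
    have h : (180 : ℝ) ≤ Real.exp 6 := by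
      have h1 : (2.7182818283 : ℝ) < Real.exp 1 := Real.exp_one_gt_d9
      have h2 : Real.exp 6 = Real.exp 1 ^ 6 := by rw [← Real.exp_nat_mul]; norm_num
      have h3 : (2.7182818283 : ℝ) ^ 6 ≤ Real.exp 1 ^ 6 :=
        pow_le_pow_left₀ (by norm_num) h1.le 6
      rw [h2]
      exact le_trans (by norm_num) h3
    calc Real.log 180 ≤ Real.log (Real.exp 6) := Real.log_le_log (by norm_num) h
      _ = 6 := Real.log_exp _
  calc Real.log (Nat.nth Nat.Prime (k + t))
      ≤ Real.log (180 * k * Real.log k) := Real.log_le_log hMpos hM'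
    _ = Real.log 180 + Real.log k + Real.log (Real.log k) := by
        rw [Real.log_mul (by positivity) (by positivity), Real.log_mul (by norm_num) (by positivity)]
    _ ≤ 1.001 * Real.log k := by linarith

/-! ### §B. The auxiliary primes `p₂, …, p_k` -/

/-- **Choice of the auxiliary primes** ([Stewart2013], proof of Lemma 8, arXiv p. 9: "let `p_j`
denote the `(j−1)`-th smallest prime which does not divide `pαβ`", `2 ≤ j ≤ k`, so that
`p_k ≤ q_{k+t+1}`): given a finite set `Bad` of at most `t + 1` forbidden numbers, among the
first `k + t` primes there are `k − 1` outside `Bad`, each at most `p_{k+t}` (`0`-indexed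
`Nat.nth Nat.Prime`). [cite: Stewart2013, proof of Lemma 8 (arXiv p. 9–10)] -/
theorem exists_auxPrimes (k t : ℕ) (Bad : Finset ℕ) (hBad : Bad.card ≤ t + 1) :
    ∃ P : Finset ℕ, P.card = k - 1 ∧
      ∀ q ∈ P, q.Prime ∧ q ∉ Bad ∧ q ≤ Nat.nth Nat.Prime (k + t) := by
  classical
  set Q : Finset ℕ := (Finset.range (k + t)).image (Nat.nth Nat.Prime) with hQ
  have hQcard : Q.card = k + t := by
    rw [hQ, Finset.card_image_of_injective _ (Nat.nth_injective Nat.infinite_setOf_prime),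
      Finset.card_range]
  have hcard : k - 1 ≤ (Q \ Bad).card := by
    have h1 : Q.card - Bad.card ≤ (Q \ Bad).card := by
      have := Finset.le_card_sdiff Bad Q
      omega
    omega
  obtain ⟨P, hPsub, hPcard⟩ := Finset.exists_subset_card_eq hcard
  refine ⟨P, hPcard, fun q hq => ?_⟩
  have hq' := hPsub hq
  rw [Finset.mem_sdiff] at hq'
  obtain ⟨hqQ, hqBad⟩ := hq'
  rw [hQ, Finset.mem_image] at hqQ
  obtain ⟨i, hi, rfl⟩ := hqQ
  rw [Finset.mem_range] at hi
  refine ⟨Nat.prime_nth_prime i, hqBad, ?_⟩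
  exact (Nat.nth_le_nth Nat.infinite_setOf_prime).2 (by omega)

/-! ### §C. The inflated family `α₁ = (a/b)/(p₂⋯p_k)`, `α_j = p_j` -/

/-- `padicValRat` of a finite product of non-zero rationals is the sum of the `padicValRat`s.
[folklore] -/
theorem padicValRat_finset_prod {ι : Type*} (p : ℕ) [Fact p.Prime] (s : Finset ι) (f : ι → ℚ)
    (hf : ∀ i ∈ s, f i ≠ 0) : padicValRat p (∏ i ∈ s, f i) = ∑ i ∈ s, padicValRat p (f i) := by
  classical
  induction s using Finset.induction_on with
  | empty => simp
  | insert a s has ih =>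
    rw [Finset.prod_insert has, Finset.sum_insert has,
      padicValRat.mul (hf a (Finset.mem_insert_self a s))
        (Finset.prod_ne_zero_iff.mpr fun i hi => hf i (Finset.mem_insert_of_mem hi)),
      ih fun i hi => hf i (Finset.mem_insert_of_mem hi)]

/-- The inflated family of [Stewart2013], proof of Lemma 8, integer case (arXiv p. 9), indexed by
`Option P` for a finite set `P` of auxiliary primes: `α none = a / (b · ∏_{q ∈ P} q)` (the paper's
`α₁ = θ/(p₂⋯p_k)`, here with `θ = α/β = a/b` itself, i.e. `v = 0`, `m = n` — the `2^v`-descent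
(24)–(27) is only needed in the quadratic case) and `α (some q) = q`.
[cite: Stewart2013, proof of Lemma 8, (31) (arXiv p. 9)] -/
def auxFamily (a b : ℕ) (P : Finset ℕ) : Option P → ℚ := fun i =>
  Option.elim i ((a : ℚ) / ((b * ∏ q ∈ P, q : ℕ) : ℚ)) fun q => ((q : ℕ) : ℚ)

/-- Unfolding `auxFamily` at `none`. [folklore] -/
@[simp] theorem auxFamily_none (a b : ℕ) (P : Finset ℕ) :
    auxFamily a b P none = (a : ℚ) / ((b * ∏ q ∈ P, q : ℕ) : ℚ) := rfl

/-- Unfolding `auxFamily` at `some q`. [folklore] -/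
@[simp] theorem auxFamily_some (a b : ℕ) (P : Finset ℕ) (q : P) :
    auxFamily a b P (some q) = ((q : ℕ) : ℚ) := rfl

section family

variable {a b : ℕ} {P : Finset ℕ}

/-- (31) of [Stewart2013]: `α₁ⁿ p₂ⁿ ⋯ p_kⁿ = (a/b)ⁿ` (with integer exponents, as Lemma 5 wants).
[cite: Stewart2013, proof of Lemma 8, (31) (arXiv p. 9)] -/
theorem prod_auxFamily_zpow (hb : 0 < b) (hP : ∀ q ∈ P, q.Prime) (n : ℕ) :
    ∏ i, auxFamily a b P i ^ (n : ℤ) = ((a : ℚ) / b) ^ n := by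
  rw [Fintype.prod_option]
  simp only [auxFamily_none, auxFamily_some, zpow_natCast]
  rw [Finset.prod_coe_sort P (fun q : ℕ => ((q : ℚ)) ^ n), Finset.prod_pow]
  have hb' : (b : ℚ) ≠ 0 := by exact_mod_cast hb.ne'
  have hprod : (∏ q ∈ P, (q : ℚ)) ≠ 0 :=
    Finset.prod_ne_zero_iff.mpr fun q hq => by exact_mod_cast (hP q hq).ne_zero
  rw [Nat.cast_mul, Nat.cast_prod, div_pow, div_pow, mul_pow]
  field_simp

/-- All members of the inflated family are non-zero. [folklore] -/
theorem auxFamily_ne_zero (ha : 0 < a) (hb : 0 < b) (hP : ∀ q ∈ P, q.Prime) (i : Option P) :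
    auxFamily a b P i ≠ 0 := by
  cases i with
  | none =>
    simp only [auxFamily_none]
    have hD : ((b * ∏ q ∈ P, q : ℕ) : ℚ) ≠ 0 := by
      have : b * ∏ q ∈ P, q ≠ 0 :=
        Nat.mul_ne_zero hb.ne' (Finset.prod_ne_zero_iff.mpr fun q hq => (hP q hq).ne_zero)
      exact_mod_cast this
    exact div_ne_zero (by exact_mod_cast ha.ne') hD
  | some q => simpa using (hP q q.2).ne_zero

/-- The members of the inflated family are `p`-adic units when `p ∤ ab` and `p ∉ P`
("since `p₂, …, p_k` are different from `p` and `p` does not divide `αβ`", arXiv p. 9).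
[cite: Stewart2013, proof of Lemma 8 (arXiv p. 9)] -/
theorem padicValRat_auxFamily {p : ℕ} (hp : p.Prime) (hpa : ¬ p ∣ a) (hpb : ¬ p ∣ b)
    (hP : ∀ q ∈ P, q.Prime ∧ q ≠ p) (i : Option P) :
    padicValRat p (auxFamily a b P i) = 0 := by
  haveI := Fact.mk hp
  cases i with
  | none =>
    simp only [auxFamily_none]
    have ha0 : (a : ℚ) ≠ 0 := by
      have : a ≠ 0 := fun h => hpa (h ▸ dvd_zero p)
      exact_mod_cast this
    have hprod : ¬ p ∣ ∏ q ∈ P, q := by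
      rw [Prime.dvd_finsetProd_iff hp.prime]
      rintro ⟨q, hq, hpq⟩
      exact (hP q hq).2 (((Nat.prime_dvd_prime_iff_eq hp (hP q hq).1).mp hpq).symm)
    have hD : ¬ p ∣ b * ∏ q ∈ P, q := by
      intro h
      rcases (Nat.Prime.dvd_mul hp).mp h with h | h
      · exact hpb h
      · exact hprod h
    have hD0 : ((b * ∏ q ∈ P, q : ℕ) : ℚ) ≠ 0 := by
      have : b * ∏ q ∈ P, q ≠ 0 := fun h => hD (h ▸ dvd_zero p)
      exact_mod_cast this
    rw [padicValRat.div ha0 hD0, padicValRat.of_nat, padicValRat.of_nat,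
      padicValNat.eq_zero_of_not_dvd hpa, padicValNat.eq_zero_of_not_dvd hD]
    simp
  | some q =>
    simp only [auxFamily_some, padicValRat.of_nat]
    have hpq : ¬ p ∣ (q : ℕ) := fun h =>
      (hP q q.2).2 (((Nat.prime_dvd_prime_iff_eq hp (hP q q.2).1).mp h).symm)
    exact_mod_cast padicValNat.eq_zero_of_not_dvd hpq

/-- Two distinct positive naturals differ in the exponent of some prime. [folklore] -/
theorem exists_prime_factorization_ne (ha : 0 < a) (hb : 0 < b) (hab : a ≠ b) :
    ∃ r : ℕ, r.Prime ∧ padicValNat r a ≠ padicValNat r b := by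
  by_contra h
  push Not at h
  apply hab
  refine Nat.eq_of_factorization_eq ha.ne' hb.ne' fun r => ?_
  by_cases hr : r.Prime
  · rw [Nat.factorization_def a hr, Nat.factorization_def b hr, h r hr]
  · rw [Nat.factorization_eq_zero_of_not_prime a hr, Nat.factorization_eq_zero_of_not_prime b hr]

/-- **Multiplicative independence of the inflated family** ("`α₁, p₂, …, p_k` are
multiplicatively independent since `α/β` is not a root of unity and `p₂, …, p_k` are primes which
do not divide `pαβ`", arXiv p. 9): if `∏ αᵢ^{cᵢ} = 1` with `cᵢ ∈ ℤ` then all `cᵢ = 0`. Proof: a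
prime `r` with `ord_r a ≠ ord_r b` divides `ab`, so lies outside `P`, and `ord_r` of the relation
gives `c_none = 0`; then `ord_q` for `q ∈ P` gives `c_q = 0`.
[cite: Stewart2013, proof of Lemma 8 (arXiv p. 9)] -/
theorem auxFamily_multIndep (ha : 0 < a) (hb : 0 < b) (hab : a ≠ b)
    (hP : ∀ q ∈ P, q.Prime ∧ ¬ q ∣ a * b) (c : Option P → ℤ)
    (hc : ∏ i, auxFamily a b P i ^ c i = 1) : c = 0 := by
  have hPp : ∀ q ∈ P, q.Prime := fun q hq => (hP q hq).1
  have hne := auxFamily_ne_zero ha hb hPp (P := P)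
  -- valuation of the relation at any prime `r`
  have hval : ∀ r : ℕ, r.Prime → ∑ i, c i * padicValRat r (auxFamily a b P i) = 0 := by
    intro r hr
    haveI := Fact.mk hr
    have h := congrArg (padicValRat r) hc
    rw [padicValRat.one,
      padicValRat_finset_prod r Finset.univ _ (fun i _ => zpow_ne_zero _ (hne i))] at h
    simpa [padicValRat.zpow] using h
  have hsome : ∀ r : ℕ, r.Prime → ∀ q : P, (q : ℕ) ≠ r →
      padicValRat r (auxFamily a b P (some q)) = 0 := by
    intro r hr q hqr
    haveI := Fact.mk hr
    rw [auxFamily_some, padicValRat.of_nat]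
    have : ¬ r ∣ (q : ℕ) := fun h =>
      hqr ((Nat.prime_dvd_prime_iff_eq hr (hPp q q.2)).mp h).symm
    exact_mod_cast padicValNat.eq_zero_of_not_dvd this
  -- Step 1: `c none = 0`, looking at a prime `r` with `ord_r a ≠ ord_r b`
  obtain ⟨r, hr, hrab⟩ := exists_prime_factorization_ne ha hb hab
  haveI := Fact.mk hr
  have hrdvd : r ∣ a * b := by
    by_contra h
    apply hrab
    rw [padicValNat.eq_zero_of_not_dvd fun h' => h (dvd_mul_of_dvd_left h' b),
      padicValNat.eq_zero_of_not_dvd fun h' => h (dvd_mul_of_dvd_right h' a)]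
  have hrP : ∀ q : P, (q : ℕ) ≠ r := by
    intro q h
    apply (hP q q.2).2
    rw [h]
    exact hrdvd
  have hnone_val : padicValRat r (auxFamily a b P none) ≠ 0 := by
    rw [auxFamily_none]
    have ha0 : (a : ℚ) ≠ 0 := by exact_mod_cast ha.ne'
    have hprod_ne : ∏ q ∈ P, q ≠ 0 :=
      Finset.prod_ne_zero_iff.mpr fun q hq => (hPp q hq).ne_zero
    have hD0 : ((b * ∏ q ∈ P, q : ℕ) : ℚ) ≠ 0 := by
      exact_mod_cast Nat.mul_ne_zero hb.ne' hprod_ne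
    have hrprod : ¬ r ∣ ∏ q ∈ P, q := by
      rw [Prime.dvd_finsetProd_iff hr.prime]
      rintro ⟨q, hq, hrq⟩
      exact hrP ⟨q, hq⟩ (((Nat.prime_dvd_prime_iff_eq hr (hPp q hq)).mp hrq).symm)
    rw [padicValRat.div ha0 hD0, padicValRat.of_nat, padicValRat.of_nat,
      padicValNat.mul hb.ne' hprod_ne, padicValNat.eq_zero_of_not_dvd hrprod, add_zero]
    omega
  have hc0 : c none = 0 := by
    have h := hval r hr
    rw [Fintype.sum_option] at h
    have hzero : ∑ q : P, c (some q) * padicValRat r (auxFamily a b P (some q)) = 0 :=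
      Finset.sum_eq_zero fun q _ => by rw [hsome r hr q (hrP q), mul_zero]
    rw [hzero, add_zero] at h
    exact (mul_eq_zero.mp h).resolve_right hnone_val
  -- Step 2: `c (some q₀) = 0`, looking at the prime `q₀`
  have hcq : ∀ q₀ : P, c (some q₀) = 0 := by
    intro q₀
    have hq₀ := hPp q₀ q₀.2
    haveI := Fact.mk hq₀
    have h := hval q₀ hq₀
    rw [Fintype.sum_option, hc0, zero_mul, zero_add, Finset.sum_eq_single q₀] at h
    · rw [auxFamily_some, padicValRat.of_nat, padicValNat_self] at h
      simpa using h
    · intro q _ hqq₀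
      rw [hsome q₀ hq₀ q (fun h => hqq₀ (Subtype.ext h)), mul_zero]
    · intro h
      exact absurd (Finset.mem_univ q₀) h
  funext i
  cases i with
  | none => exact hc0
  | some q => exact hcq q


/-- Heights of the auxiliary primes: `h(p_j) = log p_j`. [folklore] -/
theorem logHeight₁_auxFamily_some (hP : ∀ q ∈ P, q.Prime) (q : P) :
    logHeight₁ (auxFamily a b P (some q)) = Real.log (q : ℕ) := by
  haveI : NeZero (q : ℕ) := ⟨(hP q q.2).ne_zero⟩
  rw [auxFamily_some, Rat.logHeight₁_natCast]

/-- **(36)/(48) of [Stewart2013]**, integer case: `h(α₁) ≤ h(θ) + log p₂⋯p_k`; here in the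
form `h(a/(b p₂⋯p_k)) ≤ log a + log b + Σ log p_j` (from `h(xy) ≤ h(x) + h(y)`,
`h(1/y) = h(y)` and `h(m) = log m` for a positive integer `m`).
[cite: Stewart2013, proof of Lemma 8, (36) (arXiv p. 10)] -/
theorem logHeight₁_auxFamily_none_le (ha : 0 < a) (hb : 0 < b) (hP : ∀ q ∈ P, q.Prime) :
    logHeight₁ (auxFamily a b P none) ≤
      Real.log a + Real.log b + ∑ q ∈ P, Real.log (q : ℕ) := by
  have hprod_ne : ∏ q ∈ P, q ≠ 0 := Finset.prod_ne_zero_iff.mpr fun q hq => (hP q hq).ne_zero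
  haveI : NeZero a := ⟨ha.ne'⟩
  haveI : NeZero (b * ∏ q ∈ P, q) := ⟨Nat.mul_ne_zero hb.ne' hprod_ne⟩
  rw [auxFamily_none, div_eq_mul_inv]
  calc logHeight₁ ((a : ℚ) * ((b * ∏ q ∈ P, q : ℕ) : ℚ)⁻¹)
      ≤ logHeight₁ (a : ℚ) + logHeight₁ (((b * ∏ q ∈ P, q : ℕ) : ℚ)⁻¹) := logHeight₁_mul_le _ _
    _ = Real.log a + Real.log ((b * ∏ q ∈ P, q : ℕ) : ℝ) := by
        rw [logHeight₁_inv, Rat.logHeight₁_natCast, Rat.logHeight₁_natCast]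
    _ = Real.log a + Real.log b + ∑ q ∈ P, Real.log (q : ℕ) := by
        push_cast
        rw [Real.log_mul (by exact_mod_cast hb.ne')
            (Finset.prod_ne_zero_iff.mpr fun q hq => by exact_mod_cast (hP q hq).ne_zero),
          Real.log_prod (fun q hq => by exact_mod_cast (hP q hq).ne_zero)]
        ring

/-- `∏ᵢ h(αᵢ) = h(α₁) · ∏_{j} log p_j` for the inflated family. [folklore] -/
theorem prod_logHeight₁_auxFamily (hP : ∀ q ∈ P, q.Prime) :
    ∏ i, logHeight₁ (auxFamily a b P i) =
      logHeight₁ (auxFamily a b P none) * ∏ q ∈ P, Real.log (q : ℕ) := by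
  rw [Fintype.prod_option]
  congr 1
  rw [← Finset.prod_coe_sort P (fun q : ℕ => Real.log (q : ℕ))]
  exact Finset.prod_congr rfl fun q _ => logHeight₁_auxFamily_some hP q

end family

/-- For naturals `0 < b` and a prime `p ∤ b`: `ord_p((a/b)ⁿ − 1) = ord_p(aⁿ − bⁿ)`
("`ord_p((α/β)ⁿ − 1)`" of Lemma 8 versus "`ord_p(aⁿ − bⁿ)`" of Theorem 2; arXiv p. 13 reduces
the one to the other). [cite: Stewart2013, §6 (arXiv p. 13)] -/
theorem padicValRat_div_pow_sub_one {p a b : ℕ} (hp : p.Prime) (hb : 0 < b) (hpb : ¬ p ∣ b)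
    (n : ℕ) :
    padicValRat p ((((a : ℚ) / b) ^ n) - 1) = padicValInt p ((a : ℤ) ^ n - (b : ℤ) ^ n) := by
  haveI := Fact.mk hp
  have hb' : (b : ℚ) ≠ 0 := by exact_mod_cast hb.ne'
  have hrew : (((a : ℚ) / b) ^ n) - 1 = (((a : ℤ) ^ n - (b : ℤ) ^ n : ℤ) : ℚ) / ((b : ℚ) ^ n) := by
    rw [eq_div_iff (pow_ne_zero _ hb'), sub_mul, one_mul, div_pow,
      div_mul_cancel₀ _ (pow_ne_zero _ hb')]
    push_cast
    ring
  rw [hrew]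
  by_cases hz : (a : ℤ) ^ n - (b : ℤ) ^ n = 0
  · rw [hz]; simp
  · rw [padicValRat.div (by exact_mod_cast hz) (pow_ne_zero _ hb'), padicValRat.of_int,
      padicValRat.pow, padicValRat.of_nat, padicValNat.eq_zero_of_not_dvd hpb]
    simp

/-! ### §D. The real-variable estimates (33)–(38) -/

/-- `C (log L)² ≤ L` for all large `L` (from `(log L)² = o(L)`). [folklore] -/
theorem eventually_const_mul_log_sq_le (C : ℝ) :
    ∃ L₀ : ℝ, ∀ L : ℝ, L₀ ≤ L → C * Real.log L ^ 2 ≤ L := by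
  rcases le_or_gt C 0 with hC | hC
  · refine ⟨0, fun L hL => le_trans ?_ hL⟩
    exact mul_nonpos_of_nonpos_of_nonneg hC (sq_nonneg _)
  have h := (Real.isLittleO_pow_log_id_atTop (n := 2)).def (show (0 : ℝ) < 1 / C by positivity)
  obtain ⟨L₀, hL₀⟩ := Filter.eventually_atTop.mp h
  refine ⟨max L₀ 0, fun L hL => ?_⟩
  have h1 := hL₀ L (le_trans (le_max_left _ _) hL)
  have hL0 : 0 ≤ L := le_trans (le_max_right _ _) hL
  rw [Real.norm_eq_abs, Real.norm_eq_abs, abs_of_nonneg (sq_nonneg _), id, abs_of_nonneg hL0] at h1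
  calc C * Real.log L ^ 2 ≤ C * (1 / C * L) := mul_le_mul_of_nonneg_left h1 hC.le
    _ = L := by field_simp

/-- **(29) of [Stewart2013]**: with `k ≤ log p/(51.8 log log p)` (and `log log p ≥ 1`,
`log log p ≤ log p / 51.8`), `max(p (k/log p)^k, e^k log p) = p (k/log p)^k`, i.e.
`e^k L ≤ e^L (k/L)^k` for `L = log p`: indeed `k + log L + k log L ≤ 3L/51.8 ≤ L ≤ L + k log k`.
[cite: Stewart2013, proof of Lemma 8, (29) (arXiv p. 9)] -/
theorem exp_pow_mul_le {k : ℕ} {L : ℝ} (hk : 1 ≤ k) (hkL : (k : ℝ) ≤ L / (51.8 * Real.log L))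
    (hLL1 : 1 ≤ Real.log L) (hLLle : Real.log L ≤ L / 51.8) :
    Real.exp 1 ^ k * L ≤ Real.exp L * ((k : ℝ) / L) ^ k := by
  have hLLpos : 0 < Real.log L := by linarith
  have hden : 0 < 51.8 * Real.log L := by positivity
  have hk1 : (1 : ℝ) ≤ k := by exact_mod_cast hk
  have hL : 0 < L := by
    by_contra h
    push Not at h
    have : L / (51.8 * Real.log L) ≤ 0 := div_nonpos_of_nonpos_of_nonneg h hden.le
    linarith
  have h1 : (k : ℝ) * Real.log L ≤ L / 51.8 := by
    calc (k : ℝ) * Real.log L ≤ L / (51.8 * Real.log L) * Real.log L :=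
          mul_le_mul_of_nonneg_right hkL hLLpos.le
      _ = L / 51.8 := by field_simp
  have h2 : (k : ℝ) ≤ L / 51.8 := by
    calc (k : ℝ) = k * 1 := (mul_one _).symm
      _ ≤ k * Real.log L := mul_le_mul_of_nonneg_left hLL1 (by positivity)
      _ ≤ L / 51.8 := h1
  have hkpos : (0 : ℝ) < k := by linarith
  have hlogk : 0 ≤ Real.log k := Real.log_nonneg hk1
  have hlhs : Real.exp 1 ^ k * L = Real.exp (k + Real.log L) := by
    rw [Real.exp_add, ← Real.exp_nat_mul, mul_one, Real.exp_log hL]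
  have hrhs : Real.exp L * ((k : ℝ) / L) ^ k = Real.exp (L + k * (Real.log k - Real.log L)) := by
    rw [Real.exp_add, ← Real.log_div hkpos.ne' hL.ne', ← Real.log_pow,
      Real.exp_log (by positivity)]
  rw [hlhs, hrhs, Real.exp_le_exp]
  have hdist : (k : ℝ) * (Real.log k - Real.log L) = k * Real.log k - k * Real.log L := by ring
  rw [hdist]
  have hkk : 0 ≤ (k : ℝ) * Real.log k := mul_nonneg hkpos.le hlogk
  have h51 : L / 51.8 * 51.8 = L := div_mul_cancel₀ L (by norm_num)
  nlinarith

/-- `376 √(k+1) log(e⁴(k+1)) ≤ 1170 k²` for `k ≥ 3` (the factors of Lemma 5 outside the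
`max`, for `d = 1`). [folklore] -/
theorem lemma5_const_le (k : ℕ) (hk : 3 ≤ k) :
    376 * Real.sqrt (k + 1) * Real.log (Real.exp 4 * (k + 1)) ≤ 1170 * (k : ℝ) ^ 2 := by
  have hk3 : (3 : ℝ) ≤ k := by exact_mod_cast hk
  have hsqrt : Real.sqrt (k + 1) ≤ k + 1 := by
    rw [Real.sqrt_le_left (by positivity)]
    nlinarith
  have hlog : Real.log (Real.exp 4 * (k + 1)) ≤ 4 + k := by
    rw [Real.log_mul (Real.exp_pos 4).ne' (by positivity), Real.log_exp]
    have := Real.log_le_sub_one_of_pos (show (0 : ℝ) < k + 1 by positivity)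
    linarith
  have hlog0 : 0 ≤ Real.log (Real.exp 4 * (k + 1)) := by
    apply Real.log_nonneg
    have h4 : (1 : ℝ) ≤ Real.exp 4 := by have := Real.add_one_le_exp (4 : ℝ); linarith
    nlinarith
  have h1 : 376 * Real.sqrt (k + 1) * Real.log (Real.exp 4 * (k + 1)) ≤
      376 * (k + 1) * (4 + k) := by
    apply mul_le_mul _ hlog hlog0 (by positivity)
    exact mul_le_mul_of_nonneg_left hsqrt (by norm_num)
  have h2 : ((k : ℝ) + 1) * (4 + k) ≤ 28 / 9 * (k : ℝ) ^ 2 := by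
    nlinarith [mul_nonneg (sub_nonneg.2 hk3) (by positivity : (0 : ℝ) ≤ 19 / 9 * k + 4 / 3)]
  nlinarith

/-- `2A + (k−1)m ≤ 2.11 A k m` for `A ≥ log 2`, `m ≥ 1`, `k ≥ 3` (the height of `α₁`, (36)).
[folklore] -/
theorem height_factor_le (k : ℕ) (hk : 3 ≤ k) {A m : ℝ} (hA : Real.log 2 ≤ A) (hm : 1 ≤ m) :
    2 * A + (k - 1) * m ≤ 2.11 * A * k * m := by
  have hk3 : (3 : ℝ) ≤ k := by exact_mod_cast hk
  have hlog2 : (0.6931471803 : ℝ) < Real.log 2 := Real.log_two_gt_d9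
  have hA0 : 0 < A := by linarith
  have hkm : (3 : ℝ) ≤ k * m := by nlinarith
  have h1 : 2 * A ≤ 2 / 3 * A * k * m := by nlinarith [mul_nonneg hA0.le (sub_nonneg.2 hkm)]
  have h2 : ((k : ℝ) - 1) * m ≤ 1.443 * A * k * m := by
    have h3 : (1 : ℝ) ≤ 1.443 * A := by nlinarith
    nlinarith [mul_nonneg (by positivity : (0 : ℝ) ≤ k * m) (sub_nonneg.2 h3),
      (by positivity : (0 : ℝ) ≤ m)]
  linarith

/-- `max(N, (k+1) 5.4k) ≤ 10.4 k² N` for `N ≥ log 2`, `k ≥ 3` (the last factor of Lemma 5 with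
`log B = log n = N`). [folklore] -/
theorem max_log_factor_le (k : ℕ) (hk : 3 ≤ k) {N : ℝ} (hN : Real.log 2 ≤ N) :
    max N ((k + 1) * (5.4 * k)) ≤ 10.4 * (k : ℝ) ^ 2 * N := by
  have hk3 : (3 : ℝ) ≤ k := by exact_mod_cast hk
  have hlog2 : (0.6931471803 : ℝ) < Real.log 2 := Real.log_two_gt_d9
  have hN0 : 0 < N := by linarith
  refine max_le ?_ ?_
  · have h1 : (1 : ℝ) ≤ 10.4 * (k : ℝ) ^ 2 := by nlinarith
    nlinarith [mul_nonneg (sub_nonneg.2 h1) hN0.le]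
  · have h1 : ((k : ℝ) + 1) * (5.4 * k) ≤ 7.2 * (k : ℝ) ^ 2 := by nlinarith
    have h2 : 7.2 * (k : ℝ) ^ 2 ≤ 10.4 * (k : ℝ) ^ 2 * N := by
      nlinarith [mul_nonneg (sq_nonneg (k : ℝ)) (by linarith : (0 : ℝ) ≤ 10.4 * N - 7.2)]
    linarith

/-- **The chain (33)–(37) of [Stewart2013] with explicit constants** (integer case, `k ≥ 3`):
if `h₀ ≤ 2A + (k−1)m` (the height of `α₁`, `A = log a`, `m` a bound for the `log p_j`),
`Π ≤ m^{k−1}` (the product of the `h(p_j) = log p_j`), and `e^k L ≤ p (k/L)^k` ((29)), then the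
right-hand side of Lemma 5 is at most `26000 · k⁵ · (R m k / L)^k · p · A · N`
(`R = 7e(p−1)/(p−2)`, `N = log n`; the paper's "`c₆ k⁴ log p (7e (p−1)/(p−2) 1.001 k log k/log p)^k p log|α| log n`").
Ingredients: `lemma5_const_le`, `height_factor_le`, `max_log_factor_le`.
[cite: Stewart2013, proof of Lemma 8, (33)–(37) (arXiv p. 10)] -/
theorem lemma5_rhs_le (k : ℕ) (hk : 3 ≤ k) {L p A N m R h₀ Pr : ℝ} (hL : 0 < L) (hp : 0 < p)
    (hA : Real.log 2 ≤ A) (hN : Real.log 2 ≤ N) (hm : 1 ≤ m) (hR : 0 ≤ R) (hh₀ : 0 ≤ h₀)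
    (hh₀' : h₀ ≤ 2 * A + (k - 1) * m) (hPr : 0 ≤ Pr) (hPr' : Pr ≤ m ^ (k - 1))
    (hmax : Real.exp 1 ^ k * L ≤ p * (k / L) ^ k) :
    376 * Real.sqrt (k + 1) * R ^ k * Real.log (Real.exp 4 * (k + 1)) *
        max (p * (k / L) ^ k) (Real.exp 1 ^ k * L) * (h₀ * Pr) * max N ((k + 1) * (5.4 * k)) ≤
      26000 * (k : ℝ) ^ 5 * (R * m * k / L) ^ k * p * A * N := by
  have hk3 : (3 : ℝ) ≤ k := by exact_mod_cast hk
  have hlog2 : (0.6931471803 : ℝ) < Real.log 2 := Real.log_two_gt_d9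
  have hA0 : 0 < A := by linarith
  have hN0 : 0 < N := by linarith
  have hm0 : 0 ≤ m := by linarith
  have hL' : L ≠ 0 := hL.ne'
  have hF1 := lemma5_const_le k hk
  have hF2 : max (p * (k / L) ^ k) (Real.exp 1 ^ k * L) ≤ p * (k / L) ^ k := max_le le_rfl hmax
  have hF2' : 0 ≤ max (p * (k / L) ^ k) (Real.exp 1 ^ k * L) :=
    le_trans (by positivity) (le_max_right _ _)
  have hAkm : 0 ≤ 2.11 * A * k * m :=
    mul_nonneg (mul_nonneg (mul_nonneg (by norm_num) hA0.le) (by positivity)) hm0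
  have hF3 : h₀ * Pr ≤ 2.11 * A * k * m ^ k := by
    have hk1 : k - 1 + 1 = k := Nat.sub_add_cancel (by omega)
    calc h₀ * Pr ≤ (2.11 * A * k * m) * m ^ (k - 1) :=
          mul_le_mul (hh₀'.trans (height_factor_le k hk hA hm)) hPr' hPr hAkm
      _ = 2.11 * A * k * (m ^ (k - 1) * m) := by ring
      _ = 2.11 * A * k * m ^ k := by rw [← pow_succ, hk1]
  have hF4 := max_log_factor_le k hk hN
  have hF4' : 0 ≤ max N ((k + 1) * (5.4 * k)) := le_trans hN0.le (le_max_left _ _)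
  -- nonnegativity of the target factors
  have hkL0 : 0 ≤ ((k : ℝ) / L) ^ k := pow_nonneg (div_nonneg (by positivity) hL.le) k
  have hT1 : 0 ≤ 1170 * (k : ℝ) ^ 2 := by positivity
  have hT2 : 0 ≤ p * ((k : ℝ) / L) ^ k := mul_nonneg hp.le hkL0
  have hT3 : 0 ≤ 2.11 * A * k * m ^ k :=
    mul_nonneg (mul_nonneg (mul_nonneg (by norm_num) hA0.le) (by positivity)) (pow_nonneg hm0 k)
  have hRk : 0 ≤ R ^ k := by positivity
  have s1 := mul_le_mul hF1 hF2 hF2' hT1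
  have s2 := mul_le_mul s1 hF3 (mul_nonneg hh₀ hPr) (mul_nonneg hT1 hT2)
  have s3 := mul_le_mul s2 hF4 hF4' (mul_nonneg (mul_nonneg hT1 hT2) hT3)
  have s4 := mul_le_mul_of_nonneg_right s3 hRk
  calc 376 * Real.sqrt (k + 1) * R ^ k * Real.log (Real.exp 4 * (k + 1)) *
        max (p * (k / L) ^ k) (Real.exp 1 ^ k * L) * (h₀ * Pr) * max N ((k + 1) * (5.4 * k))
      = (376 * Real.sqrt (k + 1) * Real.log (Real.exp 4 * (k + 1))) *
          max (p * (k / L) ^ k) (Real.exp 1 ^ k * L) * (h₀ * Pr) *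
          max N ((k + 1) * (5.4 * k)) * R ^ k := by ring
    _ ≤ (1170 * (k : ℝ) ^ 2) * (p * (k / L) ^ k) * (2.11 * A * k * m ^ k) *
          (10.4 * (k : ℝ) ^ 2 * N) * R ^ k := s4
    _ = 25674.48 * (k : ℝ) ^ 5 * (R * m * k / L) ^ k * p * A * N := by
        rw [div_pow, div_pow, mul_pow, mul_pow]
        field_simp
        ring
    _ ≤ 26000 * (k : ℝ) ^ 5 * (R * m * k / L) ^ k * p * A * N := by
        have h0 : 0 ≤ (k : ℝ) ^ 5 * (R * m * k / L) ^ k * p * A * N := by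
          have : 0 ≤ (R * m * k / L) ^ k :=
            pow_nonneg (div_nonneg (mul_nonneg (mul_nonneg hR hm0) (by positivity)) hL.le) k
          have := mul_nonneg (mul_nonneg (mul_nonneg (mul_nonneg (by positivity : 0 ≤ (k:ℝ)^5) this) hp.le) hA0.le) hN0.le
          linarith
        nlinarith

/-- **The base of the `k`-th power is at most `1/e`**: with `k ≤ L/(51.8 log L)` and
`log k ≤ log L`, `7e · (p−1)/(p−2) · 1.001 log k · k / L ≤ 7.007 e²/51.8 · (p−1)/(p−2) · e⁻¹ ≤ e⁻¹`
once `p ≥ 2090` (as `7.007 e² < 51.7752`). This is where the printed `51.8 > 7e² · 1.001` is used.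
[cite: Stewart2013, proof of Lemma 8, (28) and (38) (arXiv p. 9–10)] -/
theorem base_le_exp_neg_one {k : ℕ} {L p : ℝ} (hp : 2090 ≤ p) (hk : 1 ≤ k)
    (hkL : (k : ℝ) ≤ L / (51.8 * Real.log L)) (hlogk : Real.log k ≤ Real.log L)
    (hLL : 0 < Real.log L) (hL : 0 < L) :
    7 * Real.exp 1 * ((p - 1) / (p - 2)) * (1.001 * Real.log k) * k / L ≤ Real.exp (-1) := by
  have hk1 : (1 : ℝ) ≤ k := by exact_mod_cast hk
  have hlogk0 : 0 ≤ Real.log k := Real.log_nonneg hk1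
  have he1 : Real.exp 1 < 2.7182818286 := Real.exp_one_lt_d9
  have he0 : 0 < Real.exp 1 := Real.exp_pos 1
  have hp2 : 0 < p - 2 := by linarith
  -- `k log k / L ≤ 1 / 51.8`
  have h1 : Real.log k * k / L ≤ 1 / 51.8 := by
    have h2 : Real.log k * k ≤ Real.log L * k := mul_le_mul_of_nonneg_right hlogk (by positivity)
    have h3 : Real.log L * k ≤ Real.log L * (L / (51.8 * Real.log L)) :=
      mul_le_mul_of_nonneg_left hkL hLL.le
    have h4 : Real.log L * (L / (51.8 * Real.log L)) = L / 51.8 := by field_simp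
    have h5 : Real.log k * k ≤ L / 51.8 := by linarith
    calc Real.log k * k / L ≤ (L / 51.8) / L := div_le_div_of_nonneg_right h5 hL.le
      _ = 1 / 51.8 := by field_simp
  -- compare with `e⁻¹`
  rw [Real.exp_neg]
  have hp1 : (0 : ℝ) ≤ p - 1 := by linarith
  have hp2' : p - 2 ≠ 0 := hp2.ne'
  have he2 : Real.exp 1 ^ 2 < 7.3890561002 := by nlinarith
  have hc0 : 0 ≤ 7 * Real.exp 1 * ((p - 1) / (p - 2)) * 1.001 :=
    mul_nonneg (mul_nonneg (by positivity) (div_nonneg hp1 hp2.le)) (by norm_num)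
  have hX : 7 * Real.exp 1 * ((p - 1) / (p - 2)) * 1.001 * (1 / 51.8) ≤ (Real.exp 1)⁻¹ := by
    rw [inv_eq_one_div, le_div_iff₀ he0]
    rw [show 7 * Real.exp 1 * ((p - 1) / (p - 2)) * 1.001 * (1 / 51.8) * Real.exp 1 =
        (7.007 * Real.exp 1 ^ 2 * (p - 1)) / (51.8 * (p - 2)) by field_simp; ring]
    rw [div_le_one (by positivity)]
    nlinarith [mul_nonneg (sub_nonneg.2 he2.le) hp1]
  calc 7 * Real.exp 1 * ((p - 1) / (p - 2)) * (1.001 * Real.log k) * k / L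
      = 7 * Real.exp 1 * ((p - 1) / (p - 2)) * 1.001 * (Real.log k * k / L) := by ring
    _ ≤ 7 * Real.exp 1 * ((p - 1) / (p - 2)) * 1.001 * (1 / 51.8) :=
        mul_le_mul_of_nonneg_left h1 hc0
    _ ≤ (Real.exp 1)⁻¹ := hX

/-- **The absorption "for `p > c₇`" of [Stewart2013], (38)**: with `ℓ = log L ≥ 12`,
`161400 ℓ² ≤ L`, `log k ≤ ℓ`, `L/(51.8 ℓ) − 1 ≤ k` and a base `β ≤ e⁻¹`,
`26000 k⁵ β^k ≤ exp(−L/(51.9 ℓ))`. Indeed `β^k ≤ e^{−k} ≤ e^{1 − L/(51.8ℓ)}`,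
`26000 k⁵ ≤ e^{10.2 + 5ℓ}`, and `11.2 + 5ℓ ≤ L/(51.8ℓ) − L/(51.9ℓ) = L/(26884.2 ℓ)`.
[cite: Stewart2013, proof of Lemma 8, (38) (arXiv p. 10)] -/
theorem absorb_pow_le_exp {k : ℕ} {L β : ℝ} (hLL : 12 ≤ Real.log L)
    (hL : 161400 * Real.log L ^ 2 ≤ L) (hk : 1 ≤ k) (hlogk : Real.log k ≤ Real.log L)
    (hkL : L / (51.8 * Real.log L) - 1 ≤ k) (hβ0 : 0 ≤ β) (hβ : β ≤ Real.exp (-1)) :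
    26000 * (k : ℝ) ^ 5 * β ^ k ≤ Real.exp (-L / (51.9 * Real.log L)) := by
  set ℓ := Real.log L with hℓ
  have hℓpos : 0 < ℓ := by linarith
  have hk1 : (1 : ℝ) ≤ k := by exact_mod_cast hk
  have hkpos : (0 : ℝ) < k := by linarith
  have h1 : β ^ k ≤ Real.exp (1 - L / (51.8 * ℓ)) := by
    calc β ^ k ≤ Real.exp (-1) ^ k := pow_le_pow_left₀ hβ0 hβ k
      _ = Real.exp (-(k : ℝ)) := by rw [← Real.exp_nat_mul]; ring_nf
      _ ≤ Real.exp (1 - L / (51.8 * ℓ)) := Real.exp_le_exp.2 (by linarith)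
  have h2 : (26000 : ℝ) ≤ Real.exp 10.2 := by
    have he : (2.7182818283 : ℝ) < Real.exp 1 := Real.exp_one_gt_d9
    have h10 : Real.exp 10 = Real.exp 1 ^ 10 := by rw [← Real.exp_nat_mul]; norm_num
    have h02 : (1 : ℝ) + 0.2 ≤ Real.exp 0.2 := by
      have := Real.add_one_le_exp (0.2 : ℝ); linarith
    have hsplit : Real.exp 10.2 = Real.exp 10 * Real.exp 0.2 := by
      rw [← Real.exp_add]; norm_num
    have hpow : (2.7182818283 : ℝ) ^ 10 ≤ Real.exp 1 ^ 10 :=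
      pow_le_pow_left₀ (by norm_num) he.le 10
    rw [hsplit, h10]
    nlinarith [pow_pos (Real.exp_pos 1) 10, Real.exp_pos (0.2 : ℝ)]
  have h3 : (k : ℝ) ^ 5 ≤ Real.exp (5 * ℓ) := by
    calc (k : ℝ) ^ 5 = Real.exp (Real.log k) ^ 5 := by rw [Real.exp_log hkpos]
      _ = Real.exp (5 * Real.log k) := by rw [← Real.exp_nat_mul]; norm_num
      _ ≤ Real.exp (5 * ℓ) := Real.exp_le_exp.2 (by linarith)
  have h4 : 10.2 + 5 * ℓ + (1 - L / (51.8 * ℓ)) ≤ -L / (51.9 * ℓ) := by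
    have hdiff : L / (51.8 * ℓ) - L / (51.9 * ℓ) = L / (26884.2 * ℓ) := by
      field_simp; ring
    have h5 : 11.2 + 5 * ℓ ≤ L / (26884.2 * ℓ) := by
      rw [le_div_iff₀ (by positivity)]
      nlinarith [mul_nonneg hℓpos.le (by linarith : (0 : ℝ) ≤ 26979 * ℓ - 301103)]
    have : -L / (51.9 * ℓ) = -(L / (51.9 * ℓ)) := by ring
    linarith
  calc 26000 * (k : ℝ) ^ 5 * β ^ k
      ≤ Real.exp 10.2 * Real.exp (5 * ℓ) * Real.exp (1 - L / (51.8 * ℓ)) :=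
        mul_le_mul (mul_le_mul h2 h3 (by positivity) (Real.exp_pos _).le) h1
          (pow_nonneg hβ0 k) (by positivity)
    _ = Real.exp (10.2 + 5 * ℓ + (1 - L / (51.8 * ℓ))) := by rw [Real.exp_add, Real.exp_add]
    _ ≤ Real.exp (-L / (51.9 * ℓ)) := Real.exp_le_exp.2 h4

/-! ### §E. Assembly: Lemma 8 (integer case) and Theorem 2 from Lemma 5 over `ℚ` -/

/-- `exp 12 ≥ 150000` and similar crude numerics. [folklore] -/
theorem exp_twelve_ge : (150000 : ℝ) ≤ Real.exp 12 := by
  have he : (2.7182818283 : ℝ) < Real.exp 1 := Real.exp_one_gt_d9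
  have h12 : Real.exp 12 = Real.exp 1 ^ 12 := by rw [← Real.exp_nat_mul]; norm_num
  have hpow : (2.7182818283 : ℝ) ^ 12 ≤ Real.exp 1 ^ 12 := pow_le_pow_left₀ (by norm_num) he.le 12
  rw [h12]
  exact le_trans (by norm_num) hpow

/-- **[Stewart2013, Lemma 8], integer case, from the printed Lemma 5 over `ℚ` with `n ≥ 7`
logarithms.** The hypothesis `hY` is the printed statement of Lemma 5 of the paper (arXiv p. 8)
for `K = ℚ` (`d = 1`, `f_℘ = 1`) with `δ` replaced by its lower bound `1` — word for word the
hypothesis of `stewart2013_lemma8Int_of_lemma5Rat` below, but indexed by `Fin n` and required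
only for `n ≥ 7` logarithms: for a prime `p ≥ 5`, non-zero rational `p`-adic units
`α₁, …, αₙ`, multiplicatively independent, `b ∈ ℤⁿ` not all zero, `B = max(2, |bᵢ|)`,
`ord_p(α₁^{b₁}⋯αₙ^{bₙ} − 1) < 376 (n+1)^{1/2} (7e (p−1)/(p−2))ⁿ log(e⁴(n+1)) ·
max(p (n/log p)ⁿ, eⁿ log p) · h(α₁)⋯h(αₙ) · max(log B, (n+1)(5.4n))`. The proof of Lemma 8
applies Lemma 5 once, with `n = k = ⌊log p/(51.8 log log p)⌋` logarithms, and `k ≥ 7` as soon as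
`p` exceeds the threshold; this is the range in which the tree's named fact
`Stewart2013_lemma5_rat` yields the printed form (`Stewart2013_lemma5_rat.printed_of`, by
`yuG1Rat_le_printed`: with Yu's published constants the printed step (19) of Stewart's
derivation holds over `ℚ` exactly for `n ≥ 7`). The conclusion is Lemma 8 for
`α = a > β = b > 0` rational integers (the binder `h8` of
`stewart2013_thm2_of_lemma8Int`). Proof: the paper's (arXiv pp. 9–10), as described in the
module docstring — `k = ⌊log p / (51.8 log log p)⌋`, auxiliary primes `p₂, …, p_k ∤ pab` among
the first `k + ω(ab)` primes (`exists_auxPrimes`), Lemma 5 for the family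
`(a/(b p₂⋯p_k), p₂, …, p_k)` with all exponents `n` (`auxFamily` on `Option P`, transported to
`Fin k` along `Fintype.equivFinOfCardEq`; (31)–(32)), the estimates (33)–(37) (`lemma5_rhs_le`,
with Chebyshev's bound `exists_log_nth_prime_le` for (34)) and the absorption (38)
(`base_le_exp_neg_one`, `absorb_pow_le_exp`). Nothing of Yu's theorem is proved here.
[cite: Stewart2013, Lemma 8 (arXiv p. 9) and Lemma 5 (arXiv p. 8)] -/
theorem stewart2013_lemma8Int_of_lemma5Rat_seven_le
    (hY : ∀ (n p : ℕ) (α : Fin n → ℚ) (b : Fin n → ℤ), 7 ≤ n → p.Prime → 5 ≤ p →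
      (∀ i, α i ≠ 0 ∧ padicValRat p (α i) = 0) →
      (∀ e : Fin n → ℤ, ∏ i, α i ^ e i = 1 → e = 0) → b ≠ 0 →
      (padicValRat p (∏ i, α i ^ b i - 1) : ℝ) <
        376 * Real.sqrt (n + 1) *
          (7 * Real.exp 1 * (((p : ℝ) - 1) / ((p : ℝ) - 2))) ^ n *
          Real.log (Real.exp 4 * (n + 1)) *
          max ((p : ℝ) * ((n : ℝ) / Real.log p) ^ n) (Real.exp 1 ^ n * Real.log p) *
          (∏ i, logHeight₁ (α i)) *
          max (Real.log ((max 2 (Finset.univ.sup fun i => (b i).natAbs) : ℕ) : ℝ))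
            ((n + 1) * (5.4 * n))) :
    ∃ C : ℕ → ℝ, ∀ a b : ℕ, 0 < b → b < a → ∀ p : ℕ, p.Prime → ¬ p ∣ a * b →
      C (ArithmeticFunction.cardDistinctFactors (a * b)) < p → ∀ n : ℕ, 1 < n →
        (padicValInt p ((a : ℤ) ^ n - (b : ℤ) ^ n) : ℝ) <
          (p : ℝ) * Real.exp (-Real.log p / (51.9 * Real.log (Real.log p))) * Real.log a *
            Real.log n := by
  classical
  obtain ⟨k₁, hk₁3, hk₁⟩ := exists_log_nth_prime_le
  obtain ⟨L₁, hL₁⟩ := eventually_const_mul_log_sq_le 161400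
  refine ⟨fun t => Real.exp (max (max (Real.exp 12) L₁) ((103.6 * ((max k₁ t : ℕ) + 4)) ^ 2)), ?_⟩
  intro a b hb hab p hp hpab hCp n hn
  -- Step 0: the parameters `L = log p`, `ℓ = log L`, thresholds
  have hp0 : (0 : ℝ) < p := by exact_mod_cast hp.pos
  have ha : 0 < a := lt_trans hb hab
  set t := ArithmeticFunction.cardDistinctFactors (a * b) with ht
  set L := Real.log p with hLdef
  have hLgt : max (max (Real.exp 12) L₁) ((103.6 * ((max k₁ t : ℕ) + 4)) ^ 2) < L := by
    rw [hLdef, Real.lt_log_iff_exp_lt hp0]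
    exact hCp
  have hL12 : Real.exp 12 ≤ L := (le_max_left _ _).trans ((le_max_left _ _).trans hLgt.le)
  have hLL₁ : L₁ ≤ L := (le_max_right _ _).trans ((le_max_left _ _).trans hLgt.le)
  have hLK : (103.6 * ((max k₁ t : ℕ) + 4 : ℝ)) ^ 2 ≤ L := (le_max_right _ _).trans hLgt.le
  have hL150000 : (150000 : ℝ) ≤ L := exp_twelve_ge.trans hL12
  have hLpos : 0 < L := by linarith
  set ℓ := Real.log L with hℓdef
  have hℓ12 : 12 ≤ ℓ := by
    rw [hℓdef, Real.le_log_iff_exp_le hLpos]; exact hL12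
  have hℓpos : 0 < ℓ := by linarith
  have hℓ1 : 1 ≤ ℓ := by linarith
  have hℓsqrt : ℓ ≤ 2 * Real.sqrt L := by
    have := Real.log_le_rpow_div hLpos.le (by norm_num : (0 : ℝ) < 1 / 2)
    rw [← Real.sqrt_eq_rpow] at this
    rw [hℓdef]; linarith
  have hsqrtK : 103.6 * ((max k₁ t : ℕ) + 4 : ℝ) ≤ Real.sqrt L := by
    rw [Real.le_sqrt (by positivity) hLpos.le]; exact hLK
  have hsqrt0 : (103.6 * 4 : ℝ) ≤ Real.sqrt L := le_trans (by
    have : (0 : ℝ) ≤ (max k₁ t : ℕ) := by positivity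
    nlinarith) hsqrtK
  have hsq : Real.sqrt L * Real.sqrt L = L := Real.mul_self_sqrt hLpos.le
  have hℓle : ℓ ≤ L / 51.8 := by
    rw [le_div_iff₀ (by norm_num)]
    nlinarith [Real.sqrt_nonneg L]
  -- `x = L/(51.8 ℓ)` and `k = ⌊x⌋`
  obtain ⟨x, hx⟩ : ∃ x : ℝ, x = L / (51.8 * ℓ) := ⟨_, rfl⟩
  have hxK : ((max k₁ t : ℕ) : ℝ) + 4 ≤ x := by
    rw [hx, le_div_iff₀ (by positivity)]
    have h0 : (0 : ℝ) ≤ (max k₁ t : ℕ) + 4 := by positivity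
    calc (((max k₁ t : ℕ) : ℝ) + 4) * (51.8 * ℓ)
        ≤ (((max k₁ t : ℕ) : ℝ) + 4) * (51.8 * (2 * Real.sqrt L)) := by
          apply mul_le_mul_of_nonneg_left _ h0
          linarith
      _ = (103.6 * (((max k₁ t : ℕ) : ℝ) + 4)) * Real.sqrt L := by ring
      _ ≤ Real.sqrt L * Real.sqrt L :=
          mul_le_mul_of_nonneg_right hsqrtK (Real.sqrt_nonneg L)
      _ = L := hsq
  have hx0 : 0 ≤ x := by rw [hx]; positivity
  obtain ⟨k, hk⟩ : ∃ k : ℕ, k = ⌊x⌋₊ := ⟨_, rfl⟩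
  have hkx : (k : ℝ) ≤ x := by rw [hk]; exact Nat.floor_le hx0
  have hxk : x < k + 1 := by rw [hk]; exact Nat.lt_floor_add_one x
  have hKk : max k₁ t + 4 ≤ k := by
    rw [hk]; apply Nat.le_floor; exact_mod_cast hxK
  have hk₁k : k₁ ≤ k := by have := le_max_left k₁ t; omega
  have htk : t ≤ k := by have := le_max_right k₁ t; omega
  have hk3 : 3 ≤ k := by omega
  have hk1 : 1 ≤ k := by omega
  have hk3r : (3 : ℝ) ≤ k := by exact_mod_cast hk3
  have hkpos : (0 : ℝ) < k := by linarith
  have hkL : (k : ℝ) ≤ L := by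
    calc (k : ℝ) ≤ x := hkx
      _ = L / (51.8 * ℓ) := hx
      _ ≤ L / 1 := div_le_div_of_nonneg_left hLpos.le one_pos (by linarith)
      _ = L := div_one L
  have hlogkℓ : Real.log k ≤ ℓ := by rw [hℓdef]; exact Real.log_le_log hkpos hkL
  -- `p` is large
  have hexpL : Real.exp L = p := by rw [hLdef, Real.exp_log hp0]
  have hp2090 : (2090 : ℝ) ≤ p := by
    rw [← hexpL]
    calc (2090 : ℝ) ≤ 1 + L := by linarith
      _ ≤ Real.exp L := by have := Real.add_one_le_exp L; linarith
  have hp5 : 5 ≤ p := by exact_mod_cast (show (5 : ℝ) ≤ p by linarith)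
  -- Step 1: the auxiliary primes
  set Bad := (p * (a * b)).primeFactors with hBad
  have hab' : a ≠ b := hab.ne'
  have habne : a * b ≠ 0 := Nat.mul_ne_zero ha.ne' hb.ne'
  have hBadcard : Bad.card ≤ t + 1 := by
    rw [hBad, Nat.primeFactors_mul hp.ne_zero habne, Nat.Prime.primeFactors hp]
    calc (({p} : Finset ℕ) ∪ (a * b).primeFactors).card
        ≤ ({p} : Finset ℕ).card + (a * b).primeFactors.card := Finset.card_union_le _ _
      _ = t + 1 := by
          rw [Finset.card_singleton, ht, ArithmeticFunction.cardDistinctFactors_apply,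
            ← List.card_toFinset, Nat.toFinset_factors]
          ring
  obtain ⟨P, hPcard, hPprop⟩ := exists_auxPrimes k t Bad hBadcard
  have hPprime : ∀ q ∈ P, q.Prime := fun q hq => (hPprop q hq).1
  have hPndvd : ∀ q ∈ P, ¬ q ∣ p * (a * b) := by
    intro q hq hdvd
    apply (hPprop q hq).2.1
    rw [hBad, Nat.mem_primeFactors]
    exact ⟨hPprime q hq, hdvd, Nat.mul_ne_zero hp.ne_zero habne⟩
  have hPab : ∀ q ∈ P, q.Prime ∧ ¬ q ∣ a * b := fun q hq =>
    ⟨hPprime q hq, fun h => hPndvd q hq (dvd_mul_of_dvd_right h p)⟩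
  have hPp : ∀ q ∈ P, q.Prime ∧ q ≠ p := fun q hq =>
    ⟨hPprime q hq, fun h => hPndvd q hq (by rw [h]; exact dvd_mul_right p (a * b))⟩
  have hpa : ¬ p ∣ a := fun h => hpab (dvd_mul_of_dvd_left h b)
  have hpb : ¬ p ∣ b := fun h => hpab (dvd_mul_of_dvd_right h a)
  -- Step 2: Lemma 5 for the inflated family with all exponents `n`, re-indexed by `Fin k`
  have hcardP : Fintype.card (Option ↥P) = k := by
    rw [Fintype.card_option, Fintype.card_coe, hPcard]; omega
  have hk7 : 7 ≤ k := by omega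
  obtain ⟨e⟩ : Nonempty (Option ↥P ≃ Fin k) := ⟨Fintype.equivFinOfCardEq hcardP⟩
  have hα' : ∀ i : Fin k, auxFamily a b P (e.symm i) ≠ 0 ∧
      padicValRat p (auxFamily a b P (e.symm i)) = 0 := fun i =>
    ⟨auxFamily_ne_zero ha hb hPprime _, padicValRat_auxFamily hp hpa hpb hPp _⟩
  have hind' : ∀ c : Fin k → ℤ, ∏ i, auxFamily a b P (e.symm i) ^ c i = 1 → c = 0 := by
    intro c hc
    have hc' : ∏ j : Option ↥P, auxFamily a b P j ^ c (e j) = 1 := by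
      rw [← hc]
      exact Fintype.prod_equiv e _ _ fun j => by rw [Equiv.symm_apply_apply]
    have h0 := auxFamily_multIndep ha hb hab' hPab (fun j => c (e j)) hc'
    funext i
    have hi := congrFun h0 (e.symm i)
    simpa using hi
  have hb0 : (fun _ : Fin k => (n : ℤ)) ≠ 0 := by
    intro h
    have := congrFun h ⟨0, by omega⟩
    simp only [Pi.zero_apply, Nat.cast_eq_zero] at this
    omega
  have hV := hY k p (fun i => auxFamily a b P (e.symm i)) (fun _ => (n : ℤ)) hk7 hp hp5 hα'
    hind' hb0
  have hprod : ∏ i : Fin k, auxFamily a b P (e.symm i) ^ (n : ℤ) = ((a : ℚ) / b) ^ n := by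
    have h1 : ∏ i : Fin k, auxFamily a b P (e.symm i) ^ (n : ℤ) =
        ∏ j : Option ↥P, auxFamily a b P j ^ (n : ℤ) :=
      Fintype.prod_equiv e.symm _ _ fun i => rfl
    rw [h1, prod_auxFamily_zpow hb hPprime n]
  have hheight : ∏ i : Fin k, logHeight₁ (auxFamily a b P (e.symm i)) =
      logHeight₁ (auxFamily a b P none) * ∏ q ∈ P, Real.log (q : ℕ) := by
    have h1 : ∏ i : Fin k, logHeight₁ (auxFamily a b P (e.symm i)) =
        ∏ j : Option ↥P, logHeight₁ (auxFamily a b P j) :=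
      Fintype.prod_equiv e.symm _ _ fun i => rfl
    rw [h1, prod_logHeight₁_auxFamily hPprime]
  have hne : (Finset.univ : Finset (Fin k)).Nonempty := ⟨⟨0, by omega⟩, Finset.mem_univ _⟩
  have hsup : (max 2 (Finset.univ.sup fun _ : Fin k => ((n : ℕ) : ℤ).natAbs) : ℕ) = n := by
    rw [Finset.sup_const hne, Int.natAbs_natCast]
    omega
  rw [hprod, padicValRat_div_pow_sub_one hp hb hpb n, hheight, hsup] at hV
  -- Step 3: the estimates (33)–(37)
  have hlog2A : Real.log 2 ≤ Real.log a :=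
    Real.log_le_log (by norm_num) (by exact_mod_cast (show 2 ≤ a by omega))
  have hlog2N : Real.log 2 ≤ Real.log n :=
    Real.log_le_log (by norm_num) (by exact_mod_cast (show 2 ≤ n by omega))
  have hlog2pos : (0 : ℝ) < Real.log 2 := Real.log_pos one_lt_two
  have hlogk1 : 1 ≤ Real.log k := by
    rw [Real.le_log_iff_exp_le hkpos]
    have := Real.exp_one_lt_d9; linarith
  have hm1 : (1 : ℝ) ≤ 1.001 * Real.log k := by linarith
  have hlogq : ∀ q ∈ P, Real.log q ≤ 1.001 * Real.log k := by
    intro q hq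
    have hq0 : (0 : ℝ) < q := by exact_mod_cast (hPprime q hq).pos
    calc Real.log q ≤ Real.log (Nat.nth Nat.Prime (k + t)) :=
          Real.log_le_log hq0 (by exact_mod_cast (hPprop q hq).2.2)
      _ ≤ 1.001 * Real.log k := hk₁ k t hk₁k htk
  have hlogq0 : ∀ q ∈ P, 0 ≤ Real.log (q : ℝ) := fun q hq =>
    Real.log_nonneg (by exact_mod_cast (hPprime q hq).one_lt.le)
  have hh₀ : 0 ≤ logHeight₁ (auxFamily a b P none) := zero_le_logHeight₁ _
  have hh₀' : logHeight₁ (auxFamily a b P none) ≤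
      2 * Real.log a + (k - 1) * (1.001 * Real.log k) := by
    have h1 := logHeight₁_auxFamily_none_le ha hb hPprime (P := P)
    have h2 : Real.log b ≤ Real.log a :=
      Real.log_le_log (by exact_mod_cast hb) (by exact_mod_cast hab.le)
    have h3 : ∑ q ∈ P, Real.log (q : ℝ) ≤ (k - 1) * (1.001 * Real.log k) := by
      have := Finset.sum_le_card_nsmul P (fun q : ℕ => Real.log (q : ℝ)) _ hlogq
      rw [hPcard, nsmul_eq_mul, Nat.cast_sub hk1, Nat.cast_one] at this
      exact this
    linarith
  have hPr0 : 0 ≤ ∏ q ∈ P, Real.log (q : ℝ) := Finset.prod_nonneg hlogq0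
  have hPr' : ∏ q ∈ P, Real.log (q : ℝ) ≤ (1.001 * Real.log k) ^ (k - 1) := by
    calc ∏ q ∈ P, Real.log (q : ℝ) ≤ ∏ _q ∈ P, (1.001 * Real.log k) :=
          Finset.prod_le_prod hlogq0 hlogq
      _ = (1.001 * Real.log k) ^ (k - 1) := by rw [Finset.prod_const, hPcard]
  have hR0 : (0 : ℝ) ≤ 7 * Real.exp 1 * (((p : ℝ) - 1) / ((p : ℝ) - 2)) := by
    have h1 : (0 : ℝ) ≤ (p : ℝ) - 1 := by linarith
    have h2 : (0 : ℝ) ≤ (p : ℝ) - 2 := by linarith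
    have := div_nonneg h1 h2
    positivity
  have hmax : Real.exp 1 ^ k * L ≤ (p : ℝ) * ((k : ℝ) / L) ^ k := by
    rw [← hexpL]
    exact exp_pow_mul_le hk1 (hx ▸ hkx) hℓ1 hℓle
  have hB1 := lemma5_rhs_le k hk3 (L := L) (p := (p : ℝ)) (A := Real.log a) (N := Real.log n)
    (m := 1.001 * Real.log k) (R := 7 * Real.exp 1 * (((p : ℝ) - 1) / ((p : ℝ) - 2)))
    (h₀ := logHeight₁ (auxFamily a b P none)) (Pr := ∏ q ∈ P, Real.log (q : ℝ))
    hLpos hp0 hlog2A hlog2N hm1 hR0 hh₀ hh₀' hPr0 hPr' hmax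
  -- Step 4: the absorption (38)
  have hβ := base_le_exp_neg_one (k := k) (L := L) hp2090 hk1 (hx ▸ hkx) hlogkℓ hℓpos hLpos
  have hβ0 : 0 ≤ 7 * Real.exp 1 * (((p : ℝ) - 1) / ((p : ℝ) - 2)) * (1.001 * Real.log k) * k / L := by
    have : 0 ≤ 1.001 * Real.log k := by linarith
    positivity
  have hB2 := absorb_pow_le_exp (k := k) (L := L) hℓ12 (hL₁ L hLL₁) hk1 hlogkℓ
    (by rw [← hx]; linarith) hβ0 hβ
  -- Step 5: conclusion
  have hA0 : 0 ≤ Real.log a := le_trans hlog2pos.le hlog2A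
  have hN0 : 0 ≤ Real.log n := le_trans hlog2pos.le hlog2N
  have hfin : 26000 * (k : ℝ) ^ 5 *
      (7 * Real.exp 1 * (((p : ℝ) - 1) / ((p : ℝ) - 2)) * (1.001 * Real.log k) * k / L) ^ k *
        p * Real.log a * Real.log n ≤
      Real.exp (-L / (51.9 * ℓ)) * p * Real.log a * Real.log n :=
    mul_le_mul_of_nonneg_right (mul_le_mul_of_nonneg_right
      (mul_le_mul_of_nonneg_right hB2 hp0.le) hA0) hN0
  have := lt_of_lt_of_le hV (hB1.trans hfin)
  calc (padicValInt p ((a : ℤ) ^ n - (b : ℤ) ^ n) : ℝ)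
      < Real.exp (-L / (51.9 * ℓ)) * p * Real.log a * Real.log n := this
    _ = (p : ℝ) * Real.exp (-L / (51.9 * ℓ)) * Real.log a * Real.log n := by ring


/-- **[Stewart2013, Lemma 8], integer case, from Lemma 5 over `ℚ`.** The hypothesis `hY` is
Lemma 5 of the paper (arXiv p. 8) — K. Yu's 2013 estimate for `p`-adic logarithmic forms [SY2]
as specialised there — for the field `K = ℚ` (`d = 1`, every `p` unramified with `f_℘ = 1`,
and `δ` replaced by its lower bound `1`, which only enlarges the printed constant): for a prime
`p ≥ 5`, multiplicatively independent non-zero rationals `α₁, …, α_k` (`k ≥ 1`) which are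
`p`-adic units, and integers `b₁, …, b_k` not all zero, `B = max(2, |b₁|, …, |b_k|)`,
`ord_p(α₁^{b₁}⋯α_k^{b_k} − 1) < 376 (k+1)^{1/2} (7e (p−1)/(p−2))^k log(e⁴(k+1)) ·
max(p (k/log p)^k, e^k log p) · h(α₁)⋯h(α_k) · max(log B, (k+1)(5.4k))`, `h = logHeight₁` the
absolute logarithmic Weil height on `ℚ`. The conclusion is Lemma 8 for `α = a > β = b > 0`
rational integers (the binder `h8` of `stewart2013_thm2_of_lemma8Int`). The proof is the
paper's (arXiv pp. 9–10): `k = ⌊log p / (51.8 log log p)⌋`, auxiliary primes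
`p₂, …, p_k ∤ pab` among the first `k + ω(ab)` primes (`exists_auxPrimes`), Lemma 5 for the
family `(a/(b p₂⋯p_k), p₂, …, p_k)` with all exponents `n` (`auxFamily`, (31)–(32)), the
estimates (33)–(37) (`lemma5_rhs_le`, with Chebyshev's bound `exists_log_nth_prime_le` for
(34)) and the absorption (38) (`base_le_exp_neg_one`, `absorb_pow_le_exp`) — carried out in
`stewart2013_lemma8Int_of_lemma5Rat_seven_le`, of which this is the corollary for `hY` stated
over an arbitrary finite index type (specialise to `ι = Fin n`, `n ≥ 7`). Yu's theorem is
NOT proved here. [cite: Stewart2013, Lemma 8 (arXiv p. 9) and Lemma 5 (arXiv p. 8)] -/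
theorem stewart2013_lemma8Int_of_lemma5Rat
    (hY : ∀ (ι : Type) [Fintype ι], 0 < Fintype.card ι →
      ∀ p : ℕ, p.Prime → 5 ≤ p →
      ∀ α : ι → ℚ, (∀ i, α i ≠ 0) → (∀ i, padicValRat p (α i) = 0) →
        (∀ c : ι → ℤ, ∏ i, α i ^ c i = 1 → c = 0) →
      ∀ b : ι → ℤ, b ≠ 0 →
        (padicValRat p (∏ i, α i ^ b i - 1) : ℝ) <
          376 * Real.sqrt (Fintype.card ι + 1) *
            (7 * Real.exp 1 * (((p : ℝ) - 1) / ((p : ℝ) - 2))) ^ Fintype.card ι *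
            Real.log (Real.exp 4 * (Fintype.card ι + 1)) *
            max ((p : ℝ) * ((Fintype.card ι : ℝ) / Real.log p) ^ Fintype.card ι)
              (Real.exp 1 ^ Fintype.card ι * Real.log p) *
            (∏ i, logHeight₁ (α i)) *
            max (Real.log ((max 2 (Finset.univ.sup fun i => (b i).natAbs) : ℕ) : ℝ))
              ((Fintype.card ι + 1) * (5.4 * Fintype.card ι))) :
    ∃ C : ℕ → ℝ, ∀ a b : ℕ, 0 < b → b < a → ∀ p : ℕ, p.Prime → ¬ p ∣ a * b →
      C (ArithmeticFunction.cardDistinctFactors (a * b)) < p → ∀ n : ℕ, 1 < n →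
        (padicValInt p ((a : ℤ) ^ n - (b : ℤ) ^ n) : ℝ) <
          (p : ℝ) * Real.exp (-Real.log p / (51.9 * Real.log (Real.log p))) * Real.log a *
            Real.log n :=
  stewart2013_lemma8Int_of_lemma5Rat_seven_le fun n p α b hn hp hp5 hα hind hb => by
    have h := hY (Fin n) (by rw [Fintype.card_fin]; omega) p hp hp5 α (fun i => (hα i).1)
      (fun i => (hα i).2) hind b hb
    rw [Fintype.card_fin] at h
    exact h

/-- **[Stewart2013, Theorem 2] from Lemma 5 over `ℚ`** (= Yu 2013 [SY2], as specialised in the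
paper): the named fact `stewart2013_thm2` follows from the statement `hY` of Lemma 5 for `K = ℚ`
(see `stewart2013_lemma8Int_of_lemma5Rat` for the dictionary), by that theorem and the §6
reduction `stewart2013_thm2_of_lemma8Int`. This pins the remaining debt of `stewart2013_thm2`
to exactly Yu's theorem over `ℚ`, which is not available in Lean. [cite: Stewart2013, Theorem 2 (arXiv p. 4), Lemma 5 (arXiv p. 8)] -/
theorem stewart2013_thm2_of_lemma5Rat
    (hY : ∀ (ι : Type) [Fintype ι], 0 < Fintype.card ι →
      ∀ p : ℕ, p.Prime → 5 ≤ p →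
      ∀ α : ι → ℚ, (∀ i, α i ≠ 0) → (∀ i, padicValRat p (α i) = 0) →
        (∀ c : ι → ℤ, ∏ i, α i ^ c i = 1 → c = 0) →
      ∀ b : ι → ℤ, b ≠ 0 →
        (padicValRat p (∏ i, α i ^ b i - 1) : ℝ) <
          376 * Real.sqrt (Fintype.card ι + 1) *
            (7 * Real.exp 1 * (((p : ℝ) - 1) / ((p : ℝ) - 2))) ^ Fintype.card ι *
            Real.log (Real.exp 4 * (Fintype.card ι + 1)) *
            max ((p : ℝ) * ((Fintype.card ι : ℝ) / Real.log p) ^ Fintype.card ι)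
              (Real.exp 1 ^ Fintype.card ι * Real.log p) *
            (∏ i, logHeight₁ (α i)) *
            max (Real.log ((max 2 (Finset.univ.sup fun i => (b i).natAbs) : ℕ) : ℝ))
              ((Fintype.card ι + 1) * (5.4 * Fintype.card ι))) :
    stewart2013_thm2 :=
  stewart2013_thm2_of_lemma8Int (stewart2013_lemma8Int_of_lemma5Rat hY)

/-! ### §F. Theorem 2 from the named fact `Stewart2013_lemma5_rat` (Yu 2013 over `ℚ`) -/

/-- **[Stewart2013, Lemma 8], integer case, from the named fact `Stewart2013_lemma5_rat`**
(`StewartYuPadicLogForms.lean`: Lemma 5 of the paper = Lemma 3.1 of the journal version over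
`ℚ`, i.e. K. Yu's 2013 Main Theorem as specialised by Stewart, in the `(3.2)–(3.3)` form
`max(log B, G₁^ℚ(n))` that the published argument establishes). For `n ≥ 7` logarithms that
fact gives the printed `max(log B, (n+1) · 5.4n)` (`Stewart2013_lemma5_rat.printed_of`), and
`δ ≥ 1` (`one_le_stewartDelta`) with `C` non-increasing in `δ` (`stewartC_anti`) replaces
Stewart's `δ` by `1`; this is the hypothesis of `stewart2013_lemma8Int_of_lemma5Rat_seven_le`
(`stewartC n p 1` unfolded, `p/1 = p`, `eⁿ = e^1^n`, `B = stewartB b`).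
[cite: Stewart2013, Lemma 8 (arXiv p. 9), from Lemma 5 (arXiv p. 8)] -/
theorem stewart2013_lemma8Int_of_Stewart2013_lemma5_rat (h : Stewart2013_lemma5_rat) :
    ∃ C : ℕ → ℝ, ∀ a b : ℕ, 0 < b → b < a → ∀ p : ℕ, p.Prime → ¬ p ∣ a * b →
      C (ArithmeticFunction.cardDistinctFactors (a * b)) < p → ∀ n : ℕ, 1 < n →
        (padicValInt p ((a : ℤ) ^ n - (b : ℤ) ^ n) : ℝ) <
          (p : ℝ) * Real.exp (-Real.log p / (51.9 * Real.log (Real.log p))) * Real.log a *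
            Real.log n :=
  stewart2013_lemma8Int_of_lemma5Rat_seven_le fun n p α b hn hp hp5 hα hind hb => by
    have h1 := h.printed_of n p α b hp hp5 hα hind hb (Or.inl hn)
    have hC : stewartC n p (stewartDelta p α) ≤ stewartC n p 1 :=
      stewartC_anti hp5 one_pos (one_le_stewartDelta hp hα)
    have hP0 : 0 ≤ ∏ i, logHeight₁ (α i) := Finset.prod_nonneg fun i _ => zero_le_logHeight₁ _
    have hM : 0 ≤ max (Real.log (stewartB b)) (((n : ℝ) + 1) * (5.4 * n)) :=
      le_max_of_le_right (by positivity)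
    have h2 := lt_of_lt_of_le h1
      (mul_le_mul_of_nonneg_right (mul_le_mul_of_nonneg_right hC hP0) hM)
    rw [stewartC_def, div_one, ← Real.exp_one_pow] at h2
    exact h2

/-- **[Stewart2013, Theorem 2] from the named fact `Stewart2013_lemma5_rat`** (= Lemma 5 of the
paper over `ℚ`, K. Yu's 2013 theorem as specialised by Stewart; `StewartYuPadicLogForms.lean`).
With this theorem the whole printed proof of Theorem 2 — §6 with (66), Lemma 8 with (28)–(38),
the prime number theorem input (34) — is formalized, and the remaining debt of the named fact
`stewart2013_thm2` is exactly the named fact `Stewart2013_lemma5_rat`, whose case of `n ≥ 2`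
logarithms is Yu's theorem on `p`-adic logarithmic forms over `ℚ`; once
`Stewart2013_lemma5_rat_holds` is in the tree, `stewart2013_thm2_holds` is this theorem applied
to it. Proof: `stewart2013_thm2_of_lemma8Int` (main file, §6 of the paper) after
`stewart2013_lemma8Int_of_Stewart2013_lemma5_rat`.
[cite: Stewart2013, Theorem 2 (arXiv p. 4), §6 (p. 13), Lemma 8 (p. 9), Lemma 5 (p. 8)] -/
theorem stewart2013_thm2_of_Stewart2013_lemma5_rat (h : Stewart2013_lemma5_rat) :
    stewart2013_thm2 :=
  stewart2013_thm2_of_lemma8Int (stewart2013_lemma8Int_of_Stewart2013_lemma5_rat h)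

/-- **Display (9) of [Stewart2013] — the record bound for Wieferich levels — from the named fact
`Stewart2013_lemma5_rat`:** there is `C₁'` depending only on `ω(ab)` such that for all integers
`a > b > 0` and primes `p ∤ ab` with `p > C₁'(ω(ab))`,
`ord_p(a^{p−1} − b^{p−1}) < p · exp(−log p / (52 log log p)) · log a`
(`stewart2013_thm2.wieferichOrder` after `stewart2013_thm2_of_Stewart2013_lemma5_rat`).
[cite: Stewart2013, (9) (arXiv p. 5)] -/
theorem stewart2013_wieferichOrder_of_Stewart2013_lemma5_rat (h : Stewart2013_lemma5_rat) :
    ∃ C₁ : ℕ → ℝ, ∀ a b : ℕ, 0 < b → b < a → ∀ p : ℕ, p.Prime → ¬ p ∣ a * b →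
      C₁ (ArithmeticFunction.cardDistinctFactors (a * b)) < p →
        (padicValInt p ((a : ℤ) ^ (p - 1) - (b : ℤ) ^ (p - 1)) : ℝ) <
          (p : ℝ) * Real.exp (-Real.log p / (52 * Real.log (Real.log p))) * Real.log a :=
  (stewart2013_thm2_of_Stewart2013_lemma5_rat h).wieferichOrder

end Literature.NumberTheory.DiophantineGeometry.Dioph
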